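import Mathlib
import Summits.NavierStokesRegularity.NavierStokesRegularity.Theorems.LerayQuarterDissipationFiniteDissipationLiouvilleThresholdOne
import Summits.NavierStokesRegularity.NavierStokesRegularity.Theorems.LerayQuarterDissipationFiniteDissipationLiouvilleSmallDissipationGapSharper
import HarnessLib

/-!
# The proved region of the crux `FiniteDissipationLiouville` in its parameter plane `(C, K)`
  (route `LerayQuarterDissipation`, stmt-NavierStokesRegularity-22144; lead prover g14, helper)

HONEST FRAMING. Bookkeeping only: one citable statement collecting the two regions of the
`(C, K)`-plane (Type-I constant `C`, quarter-rate dissipation constant `K`) on which the crux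
`FiniteDissipationLiouville` — «no Type-I ancient mild solution in the KNSS gauge obeying
`∫‖Dū(s)‖² ≤ K/√(−s)` is singular at the apex» — is at present a THEOREM of the tree:
* THRESHOLD ONE (`…ThresholdOne.exists_typeI_gap`): for every `K` there is `ε(K) > 0` such that no
  member with `C ≤ 1 + ε(K)` is singular (ineffective `ε`, by compactness);
* the SHARPER SMALL-DISSIPATION RUNG (`…SmallDissipationGap.not_singular_of_small_dissipation_sharper`):
  no member with `(√(max K 0)·(√K_S)³)⁴ < 64/27` is singular, whatever `C`
  (`K_S = SNormLESNormFDerivOfEqConst ℝ³ volume 2`).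
Outside the union — `C > 1 + ε(K)` and `(√(max K 0)·(√K_S)³)⁴ ≥ 64/27` — the crux is FRONTIER: it
contains the catalogued open problem `Literature.Analysis.FluidPDE.TypeIDSSLiouville c` for large
factors `c` (NECESSARY for the crux, `…LerayQuarterDissipationFiniteDissipationLiouvilleHardness`).
Nothing here bears on Navier–Stokes regularity or blow-up; no summit is proved.
-/

noncomputable section

set_option linter.dupNamespace false

namespace Summit.NavierStokesRegularity.NavierStokesRegularity.Theorems.FiniteDissipationLiouville.ProvedRegion

open MeasureTheory Set Metric
open Literature.Analysis Literature.Analysis.FluidPDE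
open Summit.NavierStokesRegularity.NavierStokesRegularity.Theorems

/-- **The proved region of `FiniteDissipationLiouville`.** For every dissipation constant `K` there
is `ε > 0` such that every Type-I ancient mild solution `ū` (KNSS gauge, constant `C`) obeying the
quarter-rate dissipation law with constant `K` and lying in the region
`C ≤ 1 + ε ∨ (√(max K 0)·(√K_S)³)⁴ < 64/27` is NOT singular at the apex. (Union of
`ThresholdOne.exists_typeI_gap` and `SmallDissipationGap.not_singular_of_small_dissipation_sharper`.) -/
theorem exists_gap_not_singular_of_region (K : ℝ) : ∃ ε : ℝ, 0 < ε ∧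
    ∀ (C : ℝ) (ū : ℝ → EuclideanSpace ℝ (Fin 3) → EuclideanSpace ℝ (Fin 3)),
      IsTypeIAncientMild C ū →
      (∀ s : ℝ, s < 0 → ∫⁻ x, ‖fderiv ℝ (ū s) x‖ₑ ^ 2 ≤ ENNReal.ofReal (K / Real.sqrt (-s))) →
      (C ≤ 1 + ε ∨ (Real.sqrt (max K 0) *
        Real.sqrt (SNormLESNormFDerivOfEqConst (EuclideanSpace ℝ (Fin 3))
          (volume : Measure (EuclideanSpace ℝ (Fin 3))) 2 : ℝ) ^ 3) ^ 4 < 64 / 27) →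
      ¬ (∀ r > 0, ∀ M : ℝ, ∃ t ∈ Set.Ioo (-(r ^ 2)) (0 : ℝ),
        ∃ x ∈ Metric.ball (0 : EuclideanSpace ℝ (Fin 3)) r, M < ‖ū t x‖) := by
  obtain ⟨ε, hε, hgap⟩ := ThresholdOne.exists_typeI_gap K
  refine ⟨ε, hε, fun C ū hū hK h => ?_⟩
  rcases h with h | h
  · exact hgap C h ū hū hK
  · exact SmallDissipationGap.not_singular_of_small_dissipation_sharper hū hK h

/-- **The crux restricted to the proved region, in the crux's own quantifier shape.** For all
`C, K, ū`: Type-I ancient mild with constant `C` + the law with constant `K` + membership in the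
EXPLICIT part of the region, `C ≤ 1 ∨ (√(max K 0)·(√K_S)³)⁴ < 64/27`, exclude singularity at the apex.
(The `ε(K)`-collar above `C = 1` is in `exists_gap_not_singular_of_region`.) -/
theorem not_singular_of_explicit_region (C K : ℝ)
    (ū : ℝ → EuclideanSpace ℝ (Fin 3) → EuclideanSpace ℝ (Fin 3)) (hū : IsTypeIAncientMild C ū)
    (hK : ∀ s : ℝ, s < 0 → ∫⁻ x, ‖fderiv ℝ (ū s) x‖ₑ ^ 2 ≤ ENNReal.ofReal (K / Real.sqrt (-s)))
    (h : C ≤ 1 ∨ (Real.sqrt (max K 0) *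
        Real.sqrt (SNormLESNormFDerivOfEqConst (EuclideanSpace ℝ (Fin 3))
          (volume : Measure (EuclideanSpace ℝ (Fin 3))) 2 : ℝ) ^ 3) ^ 4 < 64 / 27) :
    ¬ (∀ r > 0, ∀ M : ℝ, ∃ t ∈ Set.Ioo (-(r ^ 2)) (0 : ℝ),
        ∃ x ∈ Metric.ball (0 : EuclideanSpace ℝ (Fin 3)) r, M < ‖ū t x‖) := by
  obtain ⟨ε, hε, hreg⟩ := exists_gap_not_singular_of_region K
  refine hreg C ū hū hK (h.imp_left fun hC => ?_)
  linarith

end Summit.NavierStokesRegularity.NavierStokesRegularity.Theorems.FiniteDissipationLiouville.ProvedRegion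

end
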